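import Mathlib.Data.Nat.Sqrt
import Mathlib.Algebra.BigOperators.Group.List.Lemmas
import Mathlib.Algebra.Order.BigOperators.Group.List
import Mathlib.Algebra.Order.Group.Int
import Mathlib.Data.List.OfFn
import Mathlib.Algebra.BigOperators.Fin
import Mathlib.Algebra.Group.Action.Defs
import Mathlib.Data.List.GetD
import Mathlib.Data.Fintype.Card
import Mathlib.Tactic.Ring
import Mathlib.Tactic.Linarith
import HarnessLib

/-!
# A rounded-budget superset of the integer points of a ball, with exact counting and unranking

Topic `Literature/Algebra/EuclideanLattices` (lattice-point sampling). Everything in this file is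
PROVED (definitions with bodies and theorems; no named fact). It is groundwork for the named fact
`Literature.Algebra.EuclideanLattices.usvp_of_dihedralCoset` (Regev 2004, Thm. 1.1), more precisely
for an *exact* replacement of Regev's Lemma 3.11 (preparation of the uniform superposition `|η⟩` over
the grid points of a ball, which Regev does approximately, through a convex-body volume oracle): a
uniform superposition over a finite set `D` is exactly preparable by Hadamards, one comparison and
reversible classical arithmetic as soon as `D` can be COUNTED and UNRANKED (a bijection
`[0, #D) → D` computable in polynomial time), and the ball is then reached by one rejection step of
constant success probability.  This is Dyer's dynamic-programming paradigm for the knapsack problem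
("approximate counting by dynamic programming": count and sample exactly from the solution set of a
ROUNDED instance, which contains the true solution set and is only polynomially larger, then reject),
transplanted from `∑ wᵢ xᵢ ≤ C`, `x ∈ {0,1}ⁿ`, to `∑ zᵢ² ≤ T²`, `z ∈ ℤⁿ`.

**The region.** Fix a unit `U ≥ 1` and process the coordinates of `z = (z₀, …, z_{n−1}) ∈ ℤⁿ` in
order with an integer budget `q` (in units of `U`): `z₀` is allowed iff `z₀² ≤ q U`, and the
remaining coordinates must be allowed for the budget `q − ⌊z₀²/U⌋` (`BudgetRegion.Mem U q z`).  Then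
(`U > 0`):

* `mem_of_sum_sq_le`: `∑ zᵢ² ≤ q U → z ∈ D(q)` — the region contains the integer points of the ball
  of radius `√(qU)`;
* `sum_sq_le_of_mem`: `z ∈ D(q) → ∑ zᵢ² + n ≤ (q + n) U` — it is contained in the ball of radius
  `√((q+n)U)`; with `q ≈ n^{2+ε}` the two balls have volume ratio `≤ (1 + n/q)^{n/2} = 1 + O(n^{-ε})`
  while the budget takes only `q + 1` values, so that
* `count U n q` — the number of points of `D(q)` of length `n`, by the obvious dynamic programme over
  `(remaining length, remaining budget)` — is a sum of polynomially many terms at each of polynomially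
  many states, and
* `unrank U n q : ℕ → List ℤ` / `rank U q : List ℤ → ℕ` are inverse bijections between
  `[0, count U n q)` and the points of `D(q)` of length `n` (`mem_unrank`, `rank_unrank`,
  `unrank_rank`, `rank_lt_count`; packaged as `equivFin` and `card_eq_count`), by lexicographic
  block unranking (`blockUnrank`/`blockRank`, the folklore mixed-radix scheme).

Only the combinatorics is here; polynomial-time (reversible) implementations of `count`/`unrank` and
the quantum state preparation belong to the circuit side of the reduction.

## References

* M. Dyer, *Approximate counting by dynamic programming*, Proc. 35th STOC (2003) 693–699
  (rounded knapsack DP: exact counting and uniform sampling from a superset, then rejection; the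
  paradigm only — the paper treats `0/1` knapsack and its relatives, not sums of squares) [Dyer2003].
* A. Nijenhuis, H. S. Wilf, *Combinatorial Algorithms*, 2nd ed., Academic Press 1978, Ch. 13
  (ranking and unranking by cumulative counts).
* O. Regev, *Quantum computation and lattice problems*, SIAM J. Comput. 33 (2004), Lemma 3.11
  (the state `|η⟩` this replaces) [Regev2004].
-/

namespace Literature.Algebra.EuclideanLattices

namespace BudgetRegion

/-! ## Block ranking and unranking -/

/-- Split an index `i < ∑ sizes` into the block it falls in and the offset inside that block
(lexicographic / mixed-radix unranking); junk beyond the total. [folklore] -/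
def blockUnrank : List ℕ → ℕ → ℕ × ℕ
  | [], i => (0, i)
  | s :: rest, i =>
      if i < s then (0, i) else ((blockUnrank rest (i - s)).1 + 1, (blockUnrank rest (i - s)).2)

/-- The index of offset `o` in block `j`: the sizes of the earlier blocks plus `o`. [folklore] -/
def blockRank (sizes : List ℕ) (j o : ℕ) : ℕ := (sizes.take j).sum + o

/-- `blockUnrank` lands in a valid block and offset, and `blockRank` inverts it. [folklore] -/
theorem blockUnrank_spec : ∀ (sizes : List ℕ) (i : ℕ), i < sizes.sum →
    (blockUnrank sizes i).1 < sizes.length ∧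
      (blockUnrank sizes i).2 < sizes.getD (blockUnrank sizes i).1 0 ∧
      blockRank sizes (blockUnrank sizes i).1 (blockUnrank sizes i).2 = i
  | [], i, hi => by simp at hi
  | s :: rest, i, hi => by
      by_cases h : i < s
      · simp [blockUnrank, blockRank, h]
      · have hi' : i - s < rest.sum := by
          simp only [List.sum_cons] at hi; omega
        obtain ⟨h1, h2, h3⟩ := blockUnrank_spec rest (i - s) hi'
        simp only [blockUnrank, if_neg h]
        refine ⟨by simpa using h1, by simpa using h2, ?_⟩
        simp only [blockRank, List.take_succ_cons, List.sum_cons] at h3 ⊢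
        omega

/-- `blockUnrank ∘ blockRank = id` on valid (block, offset) pairs. [folklore] -/
theorem blockUnrank_blockRank : ∀ (sizes : List ℕ) (j o : ℕ), j < sizes.length →
    o < sizes.getD j 0 → blockUnrank sizes (blockRank sizes j o) = (j, o)
  | [], j, o, hj, _ => by simp at hj
  | s :: rest, 0, o, _, ho => by
      simp only [List.getD_cons_zero] at ho
      simp [blockUnrank, blockRank, ho]
  | s :: rest, j + 1, o, hj, ho => by
      have hj' : j < rest.length := by simpa using hj
      have ho' : o < rest.getD j 0 := by simpa using ho
      have ih := blockUnrank_blockRank rest j o hj' ho'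
      simp only [blockRank, List.take_succ_cons, List.sum_cons] at ih ⊢
      rw [blockUnrank]
      have hnot : ¬ (s + (rest.take j).sum + o < s) := by omega
      rw [if_neg hnot, show s + (rest.take j).sum + o - s = (rest.take j).sum + o by omega, ih]

/-- A valid (block, offset) pair has rank below the total. [folklore] -/
theorem blockRank_lt_sum : ∀ (sizes : List ℕ) (j o : ℕ), j < sizes.length →
    o < sizes.getD j 0 → blockRank sizes j o < sizes.sum
  | [], j, o, hj, _ => by simp at hj
  | s :: rest, 0, o, _, ho => by
      simp only [List.getD_cons_zero] at ho
      simp [blockRank]; omega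
  | s :: rest, j + 1, o, hj, ho => by
      have := blockRank_lt_sum rest j o (by simpa using hj) (by simpa using ho)
      simp only [blockRank, List.take_succ_cons, List.sum_cons] at this ⊢
      omega

/-! ## The region, its count, and the two ball containments -/

variable (U : ℕ)

/-- The cost of a coordinate: `z²` as a natural number. [folklore] -/
def sq (z : ℤ) : ℕ := z.natAbs ^ 2

/-- `sq z` as an integer is `z²`. [folklore] -/
theorem sq_cast (z : ℤ) : ((sq z : ℕ) : ℤ) = z ^ 2 := by
  rw [sq, Nat.cast_pow, Int.natAbs_sq]

/-- Membership of `z : List ℤ` in the rounded-budget region with budget `q` (in units of `U`): the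
first coordinate costs at most the budget, `z₀² ≤ qU`, and the rest lies in the region with the
ROUNDED-DOWN remaining budget `q − ⌊z₀²/U⌋`. [folklore] -/
def Mem : ℕ → List ℤ → Prop
  | _, [] => True
  | q, z :: zs => sq z ≤ q * U ∧ Mem (q - sq z / U) zs

/-- `Mem` at the empty list. [folklore] -/
@[simp] theorem mem_nil (q : ℕ) : Mem U q [] := trivial

/-- `Mem` at a cons, unfolded. [folklore] -/
@[simp] theorem mem_cons {q : ℕ} {z : ℤ} {zs : List ℤ} :
    Mem U q (z :: zs) ↔ sq z ≤ q * U ∧ Mem U (q - sq z / U) zs := Iff.rfl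

/-- Membership is decidable. [folklore] -/
instance decidableMem : (q : ℕ) → (zs : List ℤ) → Decidable (Mem U q zs)
  | _, [] => isTrue trivial
  | q, z :: zs =>
      haveI := decidableMem (q - sq z / U) zs
      inferInstanceAs (Decidable (sq z ≤ q * U ∧ Mem U (q - sq z / U) zs))

/-- The candidate values of one coordinate under budget `q`: `−s, −s+1, …, s` with `s = ⌊√(qU)⌋`.
[folklore] -/
def coordVals (q : ℕ) : List ℤ :=
  (List.range (2 * Nat.sqrt (q * U) + 1)).map fun t : ℕ => (t : ℤ) - Nat.sqrt (q * U)

/-- `z` is a candidate value iff `z² ≤ qU`. [folklore] -/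
theorem mem_coordVals {q : ℕ} {z : ℤ} : z ∈ coordVals U q ↔ sq z ≤ q * U := by
  rw [sq, ← Nat.le_sqrt']
  unfold coordVals
  rw [List.mem_map]
  constructor
  · rintro ⟨t, ht, rfl⟩
    have ht' := List.mem_range.1 ht
    omega
  · intro h
    exact ⟨(z + Nat.sqrt (q * U)).toNat, List.mem_range.2 (by omega), by omega⟩

/-- The `t`-th candidate value is `t − s`. [folklore] -/
theorem coordVals_getD {q t : ℕ} (ht : t < 2 * Nat.sqrt (q * U) + 1) :
    (coordVals U q).getD t 0 = (t : ℤ) - Nat.sqrt (q * U) := by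
  rw [List.getD_eq_getElem _ _ (by simpa [coordVals] using ht)]
  simp [coordVals]

/-- The length of the candidate list. [folklore] -/
@[simp] theorem length_coordVals (q : ℕ) : (coordVals U q).length = 2 * Nat.sqrt (q * U) + 1 := by
  simp [coordVals]

/-- The position of a candidate value `z` in the candidate list is `z + s`. [folklore] -/
theorem coordVals_getD_toNat {q : ℕ} {z : ℤ} (hz : sq z ≤ q * U) :
    (z + Nat.sqrt (q * U)).toNat < 2 * Nat.sqrt (q * U) + 1 ∧
      (coordVals U q).getD (z + Nat.sqrt (q * U)).toNat 0 = z := by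
  rw [sq, ← Nat.le_sqrt'] at hz
  have h1 : (z + Nat.sqrt (q * U)).toNat < 2 * Nat.sqrt (q * U) + 1 := by omega
  refine ⟨h1, ?_⟩
  rw [coordVals_getD U h1]
  omega

/-- **The count** of the points of length `k` of the region with budget `q`, by dynamic programming
over (remaining length, remaining budget). [folklore] -/
def count : ℕ → ℕ → ℕ
  | 0, _ => 1
  | k + 1, q => ((coordVals U q).map fun z => count k (q - sq z / U)).sum

/-- `count` at length `0`. [folklore] -/
@[simp] theorem count_zero (q : ℕ) : count U 0 q = 1 := rfl

/-- `count` at length `k + 1`, unfolded. [folklore] -/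
theorem count_succ (k q : ℕ) :
    count U (k + 1) q = ((coordVals U q).map fun z => count U k (q - sq z / U)).sum := rfl

variable {U}

/-- **Inner ball.** If `∑ zᵢ² ≤ qU` then `z` lies in the region with budget `q` (`U > 0`): the
rounded-down remaining budget never drops below the true remaining budget. [folklore] -/
theorem mem_of_sum_sq_le (hU : 0 < U) : ∀ (q : ℕ) (zs : List ℤ), (zs.map sq).sum ≤ q * U → Mem U q zs
  | _, [], _ => trivial
  | q, z :: zs, h => by
      simp only [List.map_cons, List.sum_cons] at h
      refine ⟨by omega, mem_of_sum_sq_le hU _ zs ?_⟩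
      have h1 : sq z / U * U ≤ sq z := Nat.div_mul_le_self _ _
      rw [Nat.sub_mul]
      omega

/-- **Outer ball.** A point of the region with budget `q` satisfies `∑ zᵢ² + |z| ≤ (q + |z|) U`
(`U > 0`; `|z|` the length), i.e. `∑ zᵢ² ≤ qU + |z| (U − 1)`: each rounding loses less than one unit.
[folklore] -/
theorem sum_sq_le_of_mem (hU : 0 < U) : ∀ (q : ℕ) (zs : List ℤ), Mem U q zs →
    (zs.map sq).sum + zs.length ≤ (q + zs.length) * U
  | q, [], _ => by simp
  | q, z :: zs, h => by
      obtain ⟨h1, h2⟩ := h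
      have ih := sum_sq_le_of_mem hU _ zs h2
      simp only [List.map_cons, List.sum_cons, List.length_cons]
      set t := sq z / U with ht
      have htq : t ≤ q := by
        rw [ht]
        calc sq z / U ≤ q * U / U := Nat.div_le_div_right h1
          _ = q := Nat.mul_div_cancel q hU
      have hlt : sq z < t * U + U := by
        have := Nat.lt_div_mul_add (a := sq z) hU
        rw [← ht] at this
        linarith
      have e : (q - t + zs.length) * U + t * U = (q + zs.length) * U := by
        rw [← add_mul]
        congr 1
        omega
      nlinarith

/-! ## Unranking and ranking -/

variable (U)

/-- **Unranking**: the `i`-th point (lexicographically, coordinates ordered `−s, …, s`) of length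
`k` of the region with budget `q`; junk for `i ≥ count U k q`. [folklore] -/
def unrank : ℕ → ℕ → ℕ → List ℤ
  | 0, _, _ => []
  | k + 1, q, i =>
      let p := blockUnrank ((coordVals U q).map fun z => count U k (q - sq z / U)) i
      (coordVals U q).getD p.1 0 :: unrank k (q - sq ((coordVals U q).getD p.1 0) / U) p.2

/-- **Ranking**: the position of a point of the region with budget `q` in that order. [folklore] -/
def rank : ℕ → List ℤ → ℕ
  | _, [] => 0
  | q, z :: zs =>
      blockRank ((coordVals U q).map fun z' => count U zs.length (q - sq z' / U))
        (z + Nat.sqrt (q * U)).toNat (rank (q - sq z / U) zs)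

/-- `unrank` produces lists of the requested length. [folklore] -/
theorem length_unrank : ∀ (k q i : ℕ), (unrank U k q i).length = k
  | 0, _, _ => rfl
  | k + 1, q, i => by simp [unrank, length_unrank k]

/-- `getD` of a mapped list at a valid index. [folklore] -/
theorem getD_map_count {q k j : ℕ} (hj : j < (coordVals U q).length) :
    ((coordVals U q).map fun z => count U k (q - sq z / U)).getD j 0 =
      count U k (q - sq ((coordVals U q).getD j 0) / U) := by
  rw [List.getD_eq_getElem _ _ (by simpa using hj), List.getD_eq_getElem _ _ hj]
  simp

/-- **`unrank` lands in the region** for `i < count`. [folklore] -/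
theorem mem_unrank : ∀ (k q i : ℕ), i < count U k q → Mem U q (unrank U k q i)
  | 0, _, _, _ => trivial
  | k + 1, q, i, hi => by
      rw [count_succ] at hi
      obtain ⟨h1, h2, -⟩ := blockUnrank_spec _ i hi
      set p := blockUnrank ((coordVals U q).map fun z => count U k (q - sq z / U)) i with hp
      have h1' : p.1 < (coordVals U q).length := by simpa using h1
      rw [getD_map_count U h1'] at h2
      simp only [unrank, ← hp, mem_cons]
      refine ⟨?_, mem_unrank k _ _ h2⟩
      rw [← mem_coordVals, List.getD_eq_getElem _ _ h1']
      exact List.getElem_mem h1'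

/-- **`rank ∘ unrank = id`** below `count`. [folklore] -/
theorem rank_unrank : ∀ (k q i : ℕ), i < count U k q → rank U q (unrank U k q i) = i
  | 0, q, i, hi => by simp [count] at hi; subst hi; rfl
  | k + 1, q, i, hi => by
      rw [count_succ] at hi
      obtain ⟨h1, h2, h3⟩ := blockUnrank_spec _ i hi
      set p := blockUnrank ((coordVals U q).map fun z => count U k (q - sq z / U)) i with hp
      have h1' : p.1 < (coordVals U q).length := by simpa using h1
      have h1'' : p.1 < 2 * Nat.sqrt (q * U) + 1 := by simpa using h1'
      rw [getD_map_count U h1'] at h2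
      have ih := rank_unrank k _ _ h2
      simp only [unrank, ← hp, rank, length_unrank, ih]
      have hpos : ((coordVals U q).getD p.1 0 + Nat.sqrt (q * U)).toNat = p.1 := by
        rw [coordVals_getD U h1'']; omega
      rw [hpos]
      exact h3

/-- A point of the region has rank below the count. [folklore] -/
theorem rank_lt_count : ∀ (q : ℕ) (zs : List ℤ), Mem U q zs → rank U q zs < count U zs.length q
  | q, [], _ => by simp [rank]
  | q, z :: zs, h => by
      obtain ⟨h1, h2⟩ := h
      obtain ⟨hlt, hget⟩ := coordVals_getD_toNat U h1
      have ih := rank_lt_count _ zs h2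
      simp only [List.length_cons, rank, count_succ]
      refine blockRank_lt_sum _ _ _ (by simpa using hlt) ?_
      rw [getD_map_count U (by simpa using hlt), hget]
      exact ih

/-- **`unrank ∘ rank = id`** on the region. [folklore] -/
theorem unrank_rank : ∀ (q : ℕ) (zs : List ℤ), Mem U q zs → unrank U zs.length q (rank U q zs) = zs
  | q, [], _ => rfl
  | q, z :: zs, h => by
      obtain ⟨h1, h2⟩ := h
      obtain ⟨hlt, hget⟩ := coordVals_getD_toNat U h1
      have ih := unrank_rank _ zs h2
      have hrk : rank U (q - sq z / U) zs < count U zs.length (q - sq z / U) :=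
        rank_lt_count U _ zs h2
      simp only [List.length_cons, unrank, rank]
      rw [blockUnrank_blockRank _ _ _ (by simpa using hlt) (by
        rw [getD_map_count U (by simpa using hlt), hget]; exact hrk)]
      simp only [hget]
      exact congrArg _ ih

/-! ## The bijection and the cardinality -/

/-- The points of length `k` of the region with budget `q`, as a subtype of `List ℤ`. [folklore] -/
def Pts (k q : ℕ) : Type := {zs : List ℤ // zs.length = k ∧ Mem U q zs}

/-- **`unrank` is a bijection** from `[0, count U k q)` onto the points of length `k` of the region
with budget `q`, with inverse `rank`. [folklore] -/
def equivFin (k q : ℕ) : Fin (count U k q) ≃ Pts U k q where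
  toFun i := ⟨unrank U k q i, length_unrank U k q i, mem_unrank U k q i i.2⟩
  invFun zs := ⟨rank U q zs.1, by
    have h := rank_lt_count U q zs.1 zs.2.2
    rw [zs.2.1] at h
    exact h⟩
  left_inv i := by
    apply Fin.ext
    exact rank_unrank U k q i i.2
  right_inv zs := by
    apply Subtype.ext
    have h := unrank_rank U q zs.1 zs.2.2
    rw [zs.2.1] at h
    exact h

/-- The region has finitely many points of each length. [folklore] -/
instance fintypePts (k q : ℕ) : Fintype (Pts U k q) := Fintype.ofEquiv _ (equivFin U k q)

/-- **The count is the cardinality**: `#{z ∈ D(q) : |z| = k} = count U k q`. [folklore] -/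
theorem card_eq_count (k q : ℕ) : Fintype.card (Pts U k q) = count U k q := by
  rw [← Fintype.card_fin (count U k q)]
  exact (Fintype.card_congr (equivFin U k q)).symm

/-- The zero vector lies in every region. [folklore] -/
theorem mem_replicate_zero : ∀ (k q : ℕ), Mem U q (List.replicate k 0)
  | 0, _ => trivial
  | k + 1, q => by
      rw [List.replicate_succ, mem_cons]
      refine ⟨Nat.zero_le _, ?_⟩
      simpa [sq] using mem_replicate_zero k q

/-- **The count is positive.** [folklore] -/
theorem count_pos (k q : ℕ) : 0 < count U k q := by
  rw [← card_eq_count, Fintype.card_pos_iff]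
  exact ⟨⟨List.replicate k 0, List.length_replicate, mem_replicate_zero U k q⟩⟩

/-- **Crude upper bound**: `count U k q ≤ (2⌊√(qU)⌋ + 1)ᵏ` — each coordinate has at most
`2⌊√(qU)⌋ + 1` values and budgets only decrease; so `⌈log₂ count⌉ = O(k log (qU))` index bits
suffice. [folklore] -/
theorem count_le_pow : ∀ (k q : ℕ), count U k q ≤ (2 * Nat.sqrt (q * U) + 1) ^ k
  | 0, _ => by simp
  | k + 1, q => by
      rw [count_succ, pow_succ']
      have hle : ∀ z ∈ coordVals U q, count U k (q - sq z / U) ≤ (2 * Nat.sqrt (q * U) + 1) ^ k :=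
        fun z _ => (count_le_pow k _).trans (Nat.pow_le_pow_left
          (by have := Nat.sqrt_le_sqrt (Nat.mul_le_mul_right U (Nat.sub_le q (sq z / U))); omega) k)
      calc ((coordVals U q).map fun z => count U k (q - sq z / U)).sum
          ≤ ((coordVals U q).map fun _ => (2 * Nat.sqrt (q * U) + 1) ^ k).sum :=
            List.sum_le_sum (by simpa using hle)
        _ = (2 * Nat.sqrt (q * U) + 1) * (2 * Nat.sqrt (q * U) + 1) ^ k := by
            rw [List.map_const', List.sum_replicate, length_coordVals, smul_eq_mul]

/-! ## Vectors `Fin n → ℤ` -/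

/-- **Inner ball, vector form**: `∑ᵢ zᵢ² ≤ qU → (z₀, …, z_{n−1}) ∈ D(q)`. [folklore] -/
theorem mem_ofFn_of_sum_sq_le (hU : 0 < U) {n q : ℕ} (z : Fin n → ℤ)
    (h : ∑ i, sq (z i) ≤ q * U) : Mem U q (List.ofFn z) :=
  mem_of_sum_sq_le hU q _ (by rwa [List.map_ofFn, List.sum_ofFn])

/-- **Outer ball, vector form**: `(z₀, …, z_{n−1}) ∈ D(q) → ∑ᵢ zᵢ² + n ≤ (q + n) U`. [folklore] -/
theorem sum_sq_le_of_mem_ofFn (hU : 0 < U) {n q : ℕ} (z : Fin n → ℤ)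
    (h : Mem U q (List.ofFn z)) : ∑ i, sq (z i) + n ≤ (q + n) * U := by
  have := sum_sq_le_of_mem hU q _ h
  rwa [List.map_ofFn, List.sum_ofFn, List.length_ofFn] at this

end BudgetRegion

end Literature.Algebra.EuclideanLattices
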